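import Mathlib
import HarnessLib
import Literature.Computability.AlgebraicComplexity.DiPatternExpressions
import Literature.Combinatorics.SimpleGraph.TreeDecompositionRooting
import Literature.LinearAlgebra.TensorNetworks.JunctionTree
import Summits.ValiantsHypothesis.ValiantsHypothesis.Theorems.MonotoneRestorationOrbitRestorationQPBagLabelling
import Summits.ValiantsHypothesis.ValiantsHypothesis.Theorems.MonotoneRestorationOrbitRestorationQPHomPolyCloseDP

/-!
# Route MonotoneRestoration — aside `OrbitRestorationLinearVolumeQP` (stmt-ValiantsHypothesis-18294):
# ONE-SORTED K2 — one-sorted homomorphism polynomials of patterns of treewidth `≤ w` are closed one-sorted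
# labelled pattern expressions with `w + 1` labels

The converse of the one-sorted `k`-label unfolding `DiUnfolding.close_mem_span_diHomPoly`
(`…LinearVolumeQPDiUnfolding.lean`: expression ⟹ span of `dihom` of treewidth `≤ k - 1`), i.e. the ONE-SORTED
form of the folklore bridge K2 `HomPolyClose` (`OrbitRestorationQPHomPolyClose.stub_homPoly_close`, bipartite):

  for every directed looped multigraph pattern `D : Multiset (Fin a × Fin a)` whose pattern graph has treewidth
  `≤ w`, every `n ≥ 1`, every `k ≥ w + 1` and every field `F` of characteristic `0`, there is a one-sorted
  labelled pattern expression `e : DiPatternExpr F k` with `e.close n = dihom_{D,n}`.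

The proof re-instantiates the ABSTRACT junction-tree construction of the bipartite K2
(`OrbitRestorationQPHomPolyClose.exists_expr_val_eq_sum`, `…HomPolyCloseDP.lean`: expression messages along
a rooted tree decomposition in list form) in the ONE-SORTED model — register states = label assignments
`Fin k → Fin n`, vertex `v` reads register `lab v` for a bag-injective labelling `lab ≤ w`
(`exists_bag_labelling`), `W v = sumLabel (lab v)`, factors `edge (lab u) (lab v)` — which is simpler than the
bipartite one (one sort of registers); loops `(u, u)` are housed by (T1) (`IsRootedTDOn.cover`).

* `exists_diPatternExpr_value_eq_sum` — the junction-tree expression: value `Σ_{g ∈ assignments} ∏ x_{g u, g v}`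
  at EVERY label assignment;
* `sum_assignments_eq_diHomPoly` — that sum is `dihom_{D,n}` (reindexing assignments by maps `Fin a → Fin n`);
* `exists_diClose_eq_diHomPoly` — **one-sorted K2** (close and absorb the number `n^k` of label assignments
  in a constant);
* `exists_diClose_eq_of_mem_span` — linear combinations of closed `k`-label expressions are closed `k`-label
  expressions; `diNarrowExpression_of_mem_diNarrowSpan` — hence membership in the one-sorted narrow span of
  width `w` gives ONE closed expression with `w + 1` labels (`n ≥ 1`).

With the unfolding this makes one-sorted SPAN-narrowness and one-sorted EXPRESSION-narrowness the same currency
(`…LinearVolumeQPDiNarrowSpanTight.lean`: R1 ⟺ `LvDiNarrowSpan`).  Def-free helper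
(`--supports stmt-ValiantsHypothesis-18294`), route-independent (no `Theses` import); nothing here is a named
fact; the stub `stub_lvNarrowSpan`, R1 and VP ≠ VNP are NOT moved.

References: Dawar–Pago–Seppelt 2025 (arXiv:2502.06740) §5 (proof of Thm 5.3), §7 p. 45; Dechter 1999 §4;
Lovász, *Large networks and graph limits* §6.5.
-/

noncomputable section

-- `Summit.ValiantsHypothesis.ValiantsHypothesis.…` is the tree's single-conjunct layout (Sub = Summit).
set_option linter.dupNamespace false

namespace Summit.ValiantsHypothesis.ValiantsHypothesis.Theorems.DiHomPolyClose

open MvPolynomial Literature.Computability.AlgebraicComplexity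
open Literature.Combinatorics.SimpleGraph Literature.Combinatorics.SimpleGraph.ListTD
open Literature.LinearAlgebra.TensorNetworks.JT
open Summit.ValiantsHypothesis.ValiantsHypothesis.Theorems.OrbitRestorationQPHomPolyClose

/-! ### Steps 1–2: a one-sorted expression with constant value `Σ_g ∏ x_{g u, g v}` -/

/-- **The junction-tree expression for a coded directed edge list (one-sorted model).**  Given a rooted
tree decomposition (list form) of the variables `< nv`, a bag-injective labelling `lab` with labels `< k`,
and edges `(u, v)` (vertex `v` reads register `lab v`) each housed in a bag, there is a one-sorted labelled
pattern expression with `k` labels whose value at every label assignment is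
`Σ_{g ∈ assignments (range nv) n} ∏_{(u,v)} x_{g u, g v}` (`n ≥ 1`; values read mod `n`). [folklore] -/
theorem exists_diPatternExpr_value_eq_sum {F : Type} [CommSemiring F] {n : ℕ} (hn : 0 < n)
    (k nv : ℕ) {par : List ℕ} {bags : List (List ℕ)} (hD : IsRootedTD nv par bags)
    (lab : ℕ → ℕ) (hk : ∀ v, lab v < k)
    (hinj : ∀ t, (bagOf bags t).Pairwise fun u v => lab u ≠ lab v)
    (es : List (ℕ × ℕ))
    (hcov : ∀ e ∈ es, ∃ t, t < bags.length ∧ e.1 ∈ bagOf bags t ∧ e.2 ∈ bagOf bags t) :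
    ∃ ex : DiPatternExpr F k, ∀ ℓ : Fin k → Fin n,
      ex.value n ℓ = ∑ g ∈ assignments (Finset.range nv) n,
        (es.map fun e => (X (⟨g e.1 % n, Nat.mod_lt _ hn⟩, ⟨g e.2 % n, Nat.mod_lt _ hn⟩) :
          MvPolynomial (Fin n × Fin n) F)).prod := by
  classical
  -- the model
  set fo : ℕ → Fin n := fun x => ⟨x % n, Nat.mod_lt _ hn⟩ with hfo
  have hfo_val : ∀ y : Fin n, fo y = y := fun y => Fin.ext (Nat.mod_eq_of_lt y.isLt)
  have hfo_lt : ∀ x, x < n → (fo x : ℕ) = x := fun x hx => Nat.mod_eq_of_lt hx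
  set L : ℕ → Fin k := fun v => ⟨lab v, hk v⟩ with hL
  set val : DiPatternExpr F k → (Fin k → Fin n) → MvPolynomial (Fin n × Fin n) F :=
    fun e st => e.value n st with hval
  set r : (Fin k → Fin n) → ℕ → ℕ := fun st v => (st (L v) : ℕ) with hr
  set U : (Fin k → Fin n) → ℕ → ℕ → (Fin k → Fin n) :=
    fun st v x => Function.update st (L v) (fo x) with hU
  set W : ℕ → DiPatternExpr F k → DiPatternExpr F k := fun v e => DiPatternExpr.sumLabel (L v) e with hW
  set fe : ℕ × ℕ → (ℕ → ℕ) → MvPolynomial (Fin n × Fin n) F :=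
    fun e g => X (fo (g e.1), fo (g e.2)) with hfe
  set ee : ℕ × ℕ → DiPatternExpr F k := fun e => DiPatternExpr.edge (L e.1) (L e.2) with hee
  set scope : ℕ × ℕ → List ℕ := fun e => [e.1, e.2] with hscope
  -- the hypotheses of the abstract construction
  have HW : ∀ v e st, val (W v e) st = ∑ x ∈ Finset.range n, val e (U st v x) := by
    intro v e st
    simp only [hval, hW, hU, DiPatternExpr.value_sumLabel]
    rw [← Fin.sum_univ_eq_sum_range (fun x => DiPatternExpr.value n e (Function.update st (L v) (fo x)))]
    exact Finset.sum_congr rfl fun y _ => by rw [hfo_val]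
  have Hmul : ∀ e₁ e₂ st, val (DiPatternExpr.mul e₁ e₂) st = val e₁ st * val e₂ st := fun _ _ _ => rfl
  have Hone : ∀ st, val (DiPatternExpr.const 1) st = 1 := fun st => by
    simp only [hval, DiPatternExpr.value_const, map_one]
  have Hee : ∀ e ∈ es, ∀ st, val (ee e) st = fe e (r st) := by
    intro e _ st
    simp only [hval, hee, hfe, hr, DiPatternExpr.value_edge, hfo_val]
  have Hloc : ∀ e ∈ es, ∀ g g' : ℕ → ℕ, (∀ v ∈ scope e, g v = g' v) → fe e g = fe e g' := by
    intro e _ g g' hgg'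
    simp only [hfe, hgg' e.1 (by simp [hscope]), hgg' e.2 (by simp [hscope])]
  have HU : ∀ t st, ∀ u ∈ bagOf bags t, ∀ v ∈ bagOf bags t, ∀ x, x < n →
      r (U st v x) u = if u = v then x else r st u := by
    intro t st u hu v hv x hx
    have hne : u ≠ v → lab u ≠ lab v := fun huv =>
      have : Std.Symm (fun u v : ℕ => lab u ≠ lab v) := ⟨fun _ _ h => Ne.symm h⟩
      (hinj t).forall hu hv huv
    by_cases huv : u = v
    · subst huv
      simp [hr, hU, hfo_lt x hx]
    · rw [if_neg huv]
      have hLuv : L u ≠ L v := fun h => hne huv (by simpa [hL] using congrArg Fin.val h)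
      simp [hr, hU, Function.update_of_ne hLuv]
  have Hhome : ∀ e ∈ es, homeOf bags (scope e) < bags.length := by
    intro e he
    obtain ⟨t, ht, h1, h2⟩ := hcov e he
    rw [homeOf_lt_length_iff]
    refine ⟨bags[t], List.getElem_mem ht, fun v hv => ?_⟩
    rw [← bagOf_eq_getElem ht]
    simp only [hscope, List.mem_cons, List.not_mem_nil, or_false] at hv
    rcases hv with rfl | rfl
    · exact h1
    · exact h2
  obtain ⟨ex, hex⟩ := exists_expr_val_eq_sum (val := val) (r := r) (d := n) (nv := nv) (par := par)
    (bags := bags) (scope := scope) (fe := fe) (fs := es) W U DiPatternExpr.mul (DiPatternExpr.const 1)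
    ee hD HW Hmul Hone Hee Hloc HU Hhome
  exact ⟨ex, fun ℓ => hex ℓ⟩

/-! ### Step 3: the sum over assignments is the one-sorted homomorphism polynomial -/

/-- **Reindexing**: the sum over the assignments `ℕ → ℕ` (values `< n` on `range a`, `0` elsewhere) of
`∏_{(u,v) ∈ D} x_{g u, g v}` is the one-sorted homomorphism polynomial `dihom_{D,n}`. [folklore] -/
theorem sum_assignments_eq_diHomPoly {F : Type} [CommSemiring F] {n : ℕ} (hn : 0 < n) (a : ℕ)
    (D : Multiset (Fin a × Fin a)) :
    ∑ g ∈ assignments (Finset.range a) n,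
        ((D.toList.map fun e : Fin a × Fin a => ((e.1 : ℕ), (e.2 : ℕ))).map fun e =>
          (X (⟨g e.1 % n, Nat.mod_lt _ hn⟩, ⟨g e.2 % n, Nat.mod_lt _ hn⟩) :
            MvPolynomial (Fin n × Fin n) F)).prod = diHomPoly D n F := by
  classical
  set fo : ℕ → Fin n := fun x => ⟨x % n, Nat.mod_lt _ hn⟩ with hfo
  have hfo_val : ∀ y : Fin n, fo y = y := fun y => Fin.ext (Nat.mod_eq_of_lt y.isLt)
  have hfo_lt : ∀ x, x < n → (fo x : ℕ) = x := fun x hx => Nat.mod_eq_of_lt hx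
  -- the coding of maps by assignments and back
  set Ψ : (Fin a → Fin n) → (ℕ → ℕ) := fun h v => if hv : v < a then (h ⟨v, hv⟩ : ℕ) else 0 with hΨ
  set Θ : (ℕ → ℕ) → (Fin a → Fin n) := fun g p => fo (g p) with hΘ
  have hΨ1 : ∀ h (p : Fin a), Ψ h p = h p := fun h p => by simp [hΨ, p.isLt]
  unfold diHomPoly
  symm
  refine Finset.sum_nbij' Ψ Θ (fun h _ => ?_) (fun g _ => Finset.mem_univ _) (fun h _ => ?_)
    (fun g hg => ?_) (fun h _ => ?_)
  · -- `Ψ h` is an assignment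
    rw [mem_assignments]
    refine ⟨fun v hv => ?_, fun v hv => ?_⟩
    · rw [Finset.mem_range] at hv
      simp only [hΨ, hv, dite_true]
      exact Fin.isLt _
    · rw [Finset.mem_range, not_lt] at hv
      have h1 : ¬ v < a := by omega
      simp only [hΨ, h1, dite_false]
  · -- `Θ (Ψ h) = h`
    funext p
    simp only [hΘ]
    rw [hΨ1, hfo_val]
  · -- `Ψ (Θ g) = g` on assignments
    obtain ⟨hg1, hg2⟩ := mem_assignments.1 hg
    funext v
    by_cases h1 : v < a
    · have := hΨ1 (Θ g) ⟨v, h1⟩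
      simp only at this
      rw [this]
      simp only [hΘ]
      exact hfo_lt _ (hg1 v (Finset.mem_range.2 h1))
    · have h3 : v ∉ Finset.range a := by simp; omega
      simp only [hΨ, h1, dite_false, hg2 v h3]
  · -- the summands agree
    rw [← Multiset.prod_coe, ← Multiset.map_coe, ← Multiset.map_coe, Multiset.coe_toList,
      Multiset.map_map]
    congr 1
    refine Multiset.map_congr rfl fun e _ => ?_
    simp only [Function.comp_apply]
    rw [hΨ1, hΨ1]
    congr 1
    exact Prod.ext (Fin.ext (Nat.mod_eq_of_lt (h e.1).isLt).symm)
      (Fin.ext (Nat.mod_eq_of_lt (h e.2).isLt).symm)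

/-! ### Step 4: closing, and the normalising constant -/

/-- **ONE-SORTED K2: one-sorted homomorphism polynomials of patterns of treewidth `≤ w` are closed one-sorted
labelled pattern expressions with `w + 1` labels** (any larger number of labels, any field of characteristic
`0`, `n ≥ 1`; loops allowed — a loop `(u, u)` is housed in any bag containing `u`). [folklore] -/
theorem exists_diClose_eq_diHomPoly {F : Type} [Field F] [CharZero F] {a w : ℕ}
    (D : Multiset (Fin a × Fin a))
    (htw : treewidth (SimpleGraph.fromRel fun u v : Fin a => ∃ e ∈ D, u = e.1 ∧ v = e.2) ≤ w)
    {n : ℕ} (hn : 1 ≤ n) {k : ℕ} (hk : w + 1 ≤ k) :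
    ∃ e : DiPatternExpr F k, e.close n = diHomPoly D n F := by
  classical
  have hn0 : 0 < n := hn
  -- step 0: a rooted tree decomposition in list form
  obtain ⟨par, bags, hD, hadj, hw⟩ := exists_isRootedTD_of_treewidth_le (Equiv.refl (Fin a)) htw
  -- step 1: a bag-injective labelling with labels `≤ w`
  obtain ⟨lab, hlab, hinj⟩ := exists_bag_labelling hD hw
  -- the coded edges
  set es : List (ℕ × ℕ) := D.toList.map fun e : Fin a × Fin a => ((e.1 : ℕ), (e.2 : ℕ)) with hes_def
  have hcov : ∀ e ∈ es, ∃ t, t < bags.length ∧ e.1 ∈ bagOf bags t ∧ e.2 ∈ bagOf bags t := by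
    intro e he
    obtain ⟨e', he', rfl⟩ := List.mem_map.1 he
    by_cases hloop : e'.1 = e'.2
    · -- a loop: (T1) houses its vertex
      obtain ⟨t, ht, h1⟩ := hD.cover (e'.1 : ℕ) (Finset.mem_range.2 e'.1.isLt)
      refine ⟨t, ht, h1, ?_⟩
      simpa [← hloop] using h1
    · have hadj' : (SimpleGraph.fromRel fun u v : Fin a =>
          ∃ e ∈ D, u = e.1 ∧ v = e.2).Adj e'.1 e'.2 := by
        rw [SimpleGraph.fromRel_adj]
        exact ⟨hloop, Or.inl ⟨e', Multiset.mem_toList.1 he', rfl, rfl⟩⟩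
      obtain ⟨t, ht, h1, h2⟩ := hadj _ _ hadj'
      exact ⟨t, ht, by simpa using h1, by simpa using h2⟩
  -- step 2: the expression with constant value
  obtain ⟨ex, hex⟩ := exists_diPatternExpr_value_eq_sum (F := F) hn0 k a hD lab
    (fun v => lt_of_le_of_lt (hlab v) (by omega)) hinj es hcov
  -- step 3: that value is `dihom_{D,n}`
  have hval : ∀ ℓ : Fin k → Fin n, ex.value n ℓ = diHomPoly D n F := by
    intro ℓ
    rw [hex ℓ, hes_def]
    exact sum_assignments_eq_diHomPoly hn0 a D
  -- step 4: close and normalise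
  have hnF : (n : F) ≠ 0 := Nat.cast_ne_zero.2 (by omega)
  refine ⟨DiPatternExpr.mul (DiPatternExpr.const (((n : F) ^ k)⁻¹)) ex, ?_⟩
  simp only [DiPatternExpr.close, DiPatternExpr.value_mul, DiPatternExpr.value_const, hval,
    Finset.sum_const, Finset.card_univ, Fintype.card_fun, Fintype.card_fin, nsmul_eq_mul,
    Nat.cast_pow]
  rw [← map_natCast (C : F →+* MvPolynomial (Fin n × Fin n) F) n, ← mul_assoc, ← map_pow, ← map_mul]
  have : (n : F) ^ k * ((n : F) ^ k)⁻¹ = 1 := mul_inv_cancel₀ (pow_ne_zero _ hnF)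
  rw [this, map_one, one_mul]

/-! ### Linear combinations of closed expressions -/

/-- **Linear combinations of closed one-sorted `k`-label expressions are closed `k`-label expressions**
(`close` is additive, and `c • close e = close (const c · e)`). [folklore] -/
theorem exists_diClose_eq_of_mem_span {F : Type} [Field F] {n k : ℕ} (S : Set (MvPolynomial (Fin n × Fin n) F))
    (hS : ∀ q ∈ S, ∃ e : DiPatternExpr F k, e.close n = q) (p : MvPolynomial (Fin n × Fin n) F)
    (hp : p ∈ Submodule.span F S) : ∃ e : DiPatternExpr F k, e.close n = p := by
  induction hp using Submodule.span_induction with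
  | mem q hq => exact hS q hq
  | zero =>
    refine ⟨DiPatternExpr.const 0, ?_⟩
    simp [DiPatternExpr.close]
  | add p q _ _ ihp ihq =>
    obtain ⟨e₁, he₁⟩ := ihp
    obtain ⟨e₂, he₂⟩ := ihq
    refine ⟨DiPatternExpr.add e₁ e₂, ?_⟩
    simp only [DiPatternExpr.close, DiPatternExpr.value_add, Finset.sum_add_distrib] at he₁ he₂ ⊢
    rw [he₁, he₂]
  | smul c p _ ihp =>
    obtain ⟨e, he⟩ := ihp
    refine ⟨DiPatternExpr.mul (DiPatternExpr.const c) e, ?_⟩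
    simp only [DiPatternExpr.close, DiPatternExpr.value_mul, DiPatternExpr.value_const] at he ⊢
    rw [← Finset.mul_sum, he, MvPolynomial.smul_eq_C_mul]

/-- **One-sorted narrow span ⟹ one narrow one-sorted expression.**  For `n ≥ 1`, a polynomial in the
`ℂ`-span of the one-sorted homomorphism polynomials of directed looped patterns of treewidth `≤ w` is the
closed polynomial of ONE one-sorted labelled pattern expression with `w + 1` labels (any length).
[folklore] -/
theorem diNarrowExpression_of_mem_diNarrowSpan {n : ℕ} (hn : 1 ≤ n) (w : ℕ)
    (p : MvPolynomial (Fin n × Fin n) ℂ)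
    (hp : p ∈ Submodule.span ℂ {q : MvPolynomial (Fin n × Fin n) ℂ |
      ∃ (a : ℕ) (D : Multiset (Fin a × Fin a)),
        treewidth (SimpleGraph.fromRel fun u v : Fin a => ∃ e ∈ D, u = e.1 ∧ v = e.2) ≤ w ∧
          q = diHomPoly D n ℂ}) :
    ∃ e : DiPatternExpr ℂ (w + 1), e.close n = p := by
  refine exists_diClose_eq_of_mem_span _ (fun q hq => ?_) p hp
  obtain ⟨a, D, hD, rfl⟩ := hq
  exact exists_diClose_eq_diHomPoly D hD hn le_rfl

end Summit.ValiantsHypothesis.ValiantsHypothesis.Theorems.DiHomPolyClose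

end
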